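import Literature.NumberTheory.GaloisRepresentations.WildInertia
import Literature.NumberTheory.GaloisRepresentations.QuadraticCharacterInertiaKummer
import Literature.NumberTheory.GaloisRepresentations.LocalGaloisGroupFrobeniusProofs
import Literature.NumberTheory.GaloisRepresentations.RestrictedRamification
import Literature.NumberTheory.GaloisRepresentations.EulerSystem
import Literature.NumberTheory.Automorphic.AdicCompletionResidueCard
import HarnessLib

/-!
# Cocycles of an unramified representation vanish on inertia: the tame-inertia engine of
# THEOREM B of row T-DER ([Rubin00] Thm. 4.5.1 / [MR04] Prop. A.2 — unramifiedness of Kolyvagin's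
# derivative classes away from `r p`)
# (cell `b2b-bsdres`, team n1011, seat p11 GEN 8, OWNERS row T-DER = skel/T-DER.md STATUS v5; file F6)

HONEST FRAMING (cell `b2b-bsdres`, run/shared/lean/b2b/bsd-rank1-residual/, verbatim in every
file): the goal of the cell is to DELETE the COMBINATION-SHAPED residual classes of the
Birch–Swinnerton-Dyer formula for ALL analytic-rank `≤ 1` elliptic curves over `ℚ` — "full BSD
formula for every rank `≤ 1` curve in class `C`" assembled STRICTLY from published theorems — so
that the rank-`≤ 1` remainder becomes exactly the CONSTRUCTION-SHAPED classes, which are TYPED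
(missing-input `Prop`s), NOT attempted. This is not "finishing BSD". Team n1011 (N10 / N11, the
additive block X4 ∧ `p = 3`): research route on the CONSTRUCTION-SHAPED class X4; no claim beyond the
stated classes; nothing is booked. TOOL theorems of local Galois theory and continuous group
cohomology (no definition, no named fact, no `sorry`); curve-free and coefficient-ring-free.

## What

The mechanism behind "Euler-system classes are unramified at the good primes" in the form that
needs neither Selmer structures nor universal norms ([Rubin00] Thm. 4.5.1 proves
`κ_r ∈ S^{Σ_{pr}}`; [MR04] Remark A.5: the construction even lands in the structure `𝓕_u`,
UNRAMIFIED at `ℓ ≠ p`).  Let `φ` be a continuous crossed homomorphism on an open subgroup `U`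
of an absolute Galois group with values in a topological representation `X` on which the inertia
groups at `v` act trivially.  Restricted to an inertia group `I ≤ U` it is a continuous
HOMOMORPHISM `h : I → X`, equivariant for conjugation by `U`: `h(g σ g⁻¹) = g · h(σ)` (§1).

§2 (over a non-archimedean local field `F`, `I = I_F = absInertia F`, `P = P_F = absWildInertia F ϖ`,
`q = residueFieldCard F`, `ℓ = ringChar 𝓀[F]`):
* `apply_eq_zero_of_mem_absWildInertia` — **`h` kills the WILD inertia** when `X` is
  "`ℓ'`-adically separated" (`hV`: every `x ≠ 0` lies outside some open additive subgroup `V`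
  containing `N • X` for an `N` prime to `ℓ`; e.g. `X = T_p E`, `V = ker(T_p E → E[p^n])`,
  `N = p^n`, or `X` discrete `p^k`-torsion, `V = 0`): `P_F` is pro-`ℓ` (tree
  `absWildInertia_isProP_holds`), so `ℓ^a · h(σ) ∈ V` for some `a`, and Bezout gives `h(σ) ∈ V`;
* `apply_eq_zero_of_mem_absInertia` — **`h` kills ALL of `I_F`** when moreover some Frobenius power
  `τ ∈ U` of exponent `m` has `ρ(τ) − q^m` injective on `X` (`hinj`): Frobenius acts on the tame
  inertia by `σ ↦ σ^q` (tree `conj_mul_pow_inv_mem_absWildInertia`: `τ σ τ⁻¹ ≡ σ^{q^m} mod P_F`),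
  hence `(ρ(τ) − q^m) h(σ) = h(τστ⁻¹) − h(σ^{q^m}) = h(w) = 0`, `w ∈ P_F`.

§3 (over a number field `K`, finite place `v`, `U ⊴ Γ_K` open and unramified at `v`
(`SubgroupIsUnramifiedAt`), `X` unramified at `v`):
* `apply_eq_zero_of_mem_inertia` — **every such cocycle vanishes on every inertia group `I_𝔓`,
  `𝔓 ∣ v`**, given `v`-adic separation of `X` (`hV`, with `N` prime to `v`) and injectivity of
  `ρ(Fr)^m − q_v^m` for the arithmetic Frobenii `Fr` at the primes above `v` and the exponents
  `m ≥ 1` with `Fr^m ∈ U` (`hFrob`; for `X = T_p E` at a good `v ∤ p`: `det Fr = q_v`,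
  Cayley–Hamilton in rank `2` and Hasse's `a_v² < 4 q_v` — file F8).  Proof: at the prime `𝔓₀`
  of the completion by §2 through `absGaloisRestrict K K_v` (`I_{𝔓₀} = res I_{K_v}`,
  `inertia_adicCompletionPrime_eq_map_absInertia`; `res Frob_{K_v}` is a Frobenius at `𝔓₀`,
  `isArithFrobAt_absGaloisRestrict_adicCompletionPrime_iff`), at `𝔓 = δ⁻¹ • 𝔓₀` by applying the
  `𝔓₀`-case to the conjugated cocycle `u ↦ δ · φ(δ⁻¹ u δ)`.
Consumed by F7 (`KolyvaginDerivativeUnramified.lean`: the input `hcv` of THEOREM B-ur for the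
Euler-system class `c_{⊥,r} ∈ H¹(Gal(K̄/K(r)), T)`).  Pattern and tree inputs as in
`GaloisImage/SelmerClassInertia.lean` / `PrimeChoiceLocal.lean` (which go the opposite way, from
`H¹_ur`-membership to vanishing on inertia).

References: K. Rubin, *Euler Systems* (2000), Thm. 4.5.1, Lemma 1.3.5; B. Mazur, K. Rubin,
*Kolyvagin systems*, Mem. AMS 799 (2004), App. A, Prop. A.2 and Remark A.5 (pp. 79–81);
K. Rubin, *Euler systems and Kolyvagin systems*, PCMS 18 (2011), Prop. 1.4.13 (2) (p. 9),
Exercise 1.9.2 (p. 14), §3.1 (p. 30) and Exercise 3.1.6 (2) (n1011-lit GEN 14 anchor);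
J.-P. Serre, *Local Fields* (1979), Ch. IV §2; J.-P. Serre, Invent. Math. 15 (1972), §1.3, §1.8.
-/

noncomputable section

open Field IsDedekindDomain
open scoped NumberField Pointwise ValuativeRel
open Literature.NumberTheory.GaloisRepresentations
open Literature.NumberTheory.GaloisRepresentations.IsNonarchimedeanLocalField
open Literature.NumberTheory.EllipticCurves (subgroupConj subgroupConj_apply_coe)

universe u v

namespace Summit.BirchSwinnertonDyer.Rank1Residual.GaloisImage

namespace Derivative

namespace Inertia

/-! ### §1 A cocycle is a `U`-equivariant homomorphism on a subgroup acting trivially -/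

section Hom

variable {R : Type v} [Ring R] [TopologicalSpace R]
variable {G : Type u} [Group G] [TopologicalSpace G] [IsTopologicalGroup G]
variable (X : TopRep.{u} R G) {U : Subgroup G} (φ : contOneCocycles (subgroupRep X U))

omit [IsTopologicalGroup G] in
/-- `φ(s t) = φ(s) + φ(t)` when `s` acts trivially on `X`. [folklore] -/
theorem apply_mul_eq_add (s t : U) (hs : ∀ x : X, X.ρ (s : G) x = x) :
    φ.1 (s * t) = φ.1 s + φ.1 t := by
  rw [subgroup_cocycle_mul, hs]

omit [IsTopologicalGroup G] in
/-- `φ(s ^ n) = n • φ(s)` when `s` acts trivially on `X`. [folklore] -/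
theorem apply_pow_eq_nsmul (s : U) (hs : ∀ x : X, X.ρ (s : G) x = x) (n : ℕ) :
    φ.1 (s ^ n) = n • φ.1 s := by
  induction n with
  | zero => rw [pow_zero, zero_nsmul]; exact contOneCocycles.apply_one φ
  | succ n ih => rw [pow_succ', apply_mul_eq_add X φ s _ hs, ih, succ_nsmul']

omit [IsTopologicalGroup G] in
/-- `φ(t s t⁻¹) = t · φ(s)` when `s` acts trivially on `X` (`φ(t) + t · φ(t⁻¹) = φ(1) = 0`).
[folklore] -/
theorem apply_conj_eq (t s : U) (hs : ∀ x : X, X.ρ (s : G) x = x) :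
    φ.1 (t * s * t⁻¹) = X.ρ (t : G) (φ.1 s) := by
  have h1 := subgroup_cocycle_mul X U φ (t * s) t⁻¹
  have h2 := subgroup_cocycle_mul X U φ t s
  have h3 := subgroup_cocycle_mul X U φ t t⁻¹
  rw [mul_inv_cancel, contOneCocycles.apply_one] at h3
  have hts : ∀ x : X, X.ρ ((t * s : U) : G) x = X.ρ (t : G) x := fun x => by
    rw [Subgroup.coe_mul, ρ_mul_apply, hs]
  rw [h1, h2, hts, add_assoc, add_comm (X.ρ (t : G) (φ.1 s)), ← add_assoc, ← h3, zero_add]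

end Hom

/-! ### §2 Over a non-archimedean local field: wild inertia, then tame inertia -/

section Local

variable {F : Type u} [Field F] [ValuativeRel F] [TopologicalSpace F] [IsNonarchimedeanLocalField F]
variable {R : Type v} [Ring R] [TopologicalSpace R]
variable (X : TopRep.{u} R (absoluteGaloisGroup F)) {U : Subgroup (absoluteGaloisGroup F)}
  (hIU : absInertia F ≤ U) (φ : contOneCocycles (subgroupRep X U))

/-- Powers of an arithmetic Frobenius are Frobenius powers: `IsFrobPow (φ₀ ^ k) k` (twin of the
tree's `isFrobPow_pow` of `LocalFieldCdTwo`, re-proved here to keep the imports light; from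
`IsFrobPow.mul_holds`).  Tate, Corvallis (1979), (1.4.1). [folklore] -/
theorem isFrobPow_pow_natCast {φ₀ : absoluteGaloisGroup F} (h : IsFrobPow φ₀ 1) (k : ℕ) :
    IsFrobPow (φ₀ ^ k) (k : ℤ) := by
  induction k with
  | zero => rw [pow_zero, Nat.cast_zero]; exact IsFrobPow.one
  | succ k ih => rw [pow_succ, Nat.cast_succ]; exact IsFrobPow.mul_holds ih h

/-- **A cocycle of an unramified, `ℓ'`-adically separated representation kills the wild inertia.**
For `σ ∈ P_F` and `x = φ(σ) ≠ 0` take `V ∌ x` open with `N • X ⊆ V`, `ℓ ∤ N` (`hV`); the set of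
`u ∈ U` with `φ(u) ∈ V` is an open neighbourhood of `1` in `Γ_F`, so contains some
`Gal(F̄/L)`, `[L : F] < ∞` (Krull topology), hence `σ^{ℓ^a}` for some `a` (`P_F` is pro-`ℓ`,
`absWildInertia_isProP_holds`): `ℓ^a • x ∈ V`; with `N • x ∈ V` and `gcd(ℓ^a, N) = 1`, `x ∈ V`,
a contradiction.  Serre, *Local Fields*, Ch. IV §2, Cor. 3 of Prop. 7 (`G_1` is a `p`-group);
Rubin, *Euler Systems*, Lemma 1.3.5 (context). [folklore] -/
theorem apply_eq_zero_of_mem_absWildInertia (hU : IsOpen (U : Set (absoluteGaloisGroup F)))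
    (hX : ∀ σ ∈ absInertia F, ∀ x : X, X.ρ σ x = x)
    (hV : ∀ x : X, x ≠ 0 → ∃ (V : AddSubgroup X) (N : ℕ), IsOpen (V : Set X) ∧ x ∉ V ∧
      ¬ ringChar 𝓀[F] ∣ N ∧ ∀ y : X, N • y ∈ V)
    {ϖ : 𝒪[F]} (hϖ : Irreducible ϖ) {σ : absoluteGaloisGroup F} (hσ : σ ∈ absWildInertia F ϖ) :
    φ.1 ⟨σ, hIU (absWildInertia_le_absInertia F ϖ hσ)⟩ = 0 := by
  have hσI : σ ∈ absInertia F := absWildInertia_le_absInertia F ϖ hσ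
  by_contra hne
  obtain ⟨V, N, hVo, hxV, hN, hNV⟩ := hV _ hne
  -- the open neighbourhood `W = {u ∈ U | φ u ∈ V}` of `1` in `Γ_F`
  set W : Set (absoluteGaloisGroup F) := Subtype.val '' {u : U | φ.1 u ∈ (V : Set X)} with hW
  have hWo : IsOpen W := hU.isOpenMap_subtype_val _ (hVo.preimage φ.1.continuous)
  have h1W : (1 : absoluteGaloisGroup F) ∈ W :=
    ⟨1, by simp only [Set.mem_setOf_eq, contOneCocycles.apply_one, SetLike.mem_coe, zero_mem], rfl⟩
  obtain ⟨L, hLfd, hLW⟩ :=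
    (krullTopology_mem_nhds_one_iff F (AlgebraicClosure F) W).mp (hWo.mem_nhds h1W)
  haveI := hLfd
  obtain ⟨a, ha⟩ := absWildInertia_isProP_holds F hϖ hσ L.fixingSubgroup
    (IntermediateField.fixingSubgroup_isOpen L)
  obtain ⟨u, hu, hu'⟩ := hLW ha
  -- `u = σ ^ ℓ^a` as elements of `U`, so `ℓ^a • φ(σ) ∈ V`
  have hueq : u = (⟨σ, hIU hσI⟩ : U) ^ (ringChar 𝓀[F] ^ a) :=
    Subtype.ext (by rw [hu', Subgroup.coe_pow])
  have hmem : (ringChar 𝓀[F] ^ a) • φ.1 ⟨σ, hIU hσI⟩ ∈ V := by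
    have h : φ.1 u ∈ (V : Set X) := hu
    rwa [hueq, apply_pow_eq_nsmul X φ _ (hX σ hσI)] at h
  -- Bezout: `gcd(ℓ^a, N) = 1`
  have hcop : Nat.Coprime (ringChar 𝓀[F] ^ a) N :=
    Nat.Coprime.pow_left a ((Nat.Prime.coprime_iff_not_dvd (ringChar_residueField_prime (F := F))).mpr hN)
  set x : X := φ.1 ⟨σ, hIU hσI⟩ with hx
  have hbez : x = (Nat.gcdA (ringChar 𝓀[F] ^ a) N) • (((ringChar 𝓀[F] ^ a : ℕ) : ℤ) • x) +
      (Nat.gcdB (ringChar 𝓀[F] ^ a) N) • (((N : ℕ) : ℤ) • x) := by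
    rw [smul_smul, smul_smul, ← add_smul, mul_comm (Nat.gcdA _ _), mul_comm (Nat.gcdB _ _),
      ← Nat.gcd_eq_gcd_ab, hcop.gcd_eq_one, Nat.cast_one, one_smul]
  apply hxV
  rw [hbez]
  refine V.add_mem (V.zsmul_mem ?_ _) (V.zsmul_mem ?_ _)
  · rw [natCast_zsmul]; exact hmem
  · rw [natCast_zsmul]; exact hNV x

/-- **A cocycle of an unramified representation vanishes on the inertia group when a Frobenius
power `τ ∈ U` has `ρ(τ) − q^m` injective** (the tame step): for `σ ∈ I_F`,
`τ σ τ⁻¹ = w · σ^{q^m}` with `w ∈ P_F` (`conj_mul_pow_inv_mem_absWildInertia`), so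
`τ · φ(σ) = φ(τστ⁻¹) = φ(w) + q^m • φ(σ) = q^m • φ(σ)` (wild step), and `hinj` gives `φ(σ) = 0`.
This is the "Frobenius has no eigenvalue `q^m` on `Hom(I_F, X)^{G}`" mechanism of
`H¹(F, A)/H¹_u(F, A) ≅ Hom(I_F, A)^{G_F}` with the tame quotient of `I_F` being `∏_{ℓ' ≠ ℓ} μ_{ℓ'^∞}`
(Rubin, PCMS 18, Prop. 1.4.13 (2) and Exercise 1.9.2; §3.1 p. 30: "`Hom(I_{ℚ_ℓ}, A)` is
torsion-free, so `H¹_{𝓕can}(ℚ_ℓ, A) = H¹_u(ℚ_ℓ, A)`"), for cocycles defined only on an open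
`U ∋ τ`; Rubin, *Euler Systems*, Lemma 1.3.5 / Thm. 4.5.1; Serre, Invent. Math. 15 (1972) §1.8
Prop. 6 for `s u s⁻¹ ≡ u^q`.
[cite: Rubin2011, Prop. 1.4.13 (2) (p. 9) and Exercise 1.9.2 (p. 14)] -/
theorem apply_eq_zero_of_mem_absInertia (hU : IsOpen (U : Set (absoluteGaloisGroup F)))
    (hX : ∀ σ ∈ absInertia F, ∀ x : X, X.ρ σ x = x)
    (hV : ∀ x : X, x ≠ 0 → ∃ (V : AddSubgroup X) (N : ℕ), IsOpen (V : Set X) ∧ x ∉ V ∧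
      ¬ ringChar 𝓀[F] ∣ N ∧ ∀ y : X, N • y ∈ V)
    {τ : absoluteGaloisGroup F} (hτU : τ ∈ U) {m : ℕ} (hτ : IsFrobPow τ m)
    (hinj : Function.Injective fun x : X => X.ρ τ x - ((residueFieldCard F : R) ^ m) • x)
    {σ : absoluteGaloisGroup F} (hσ : σ ∈ absInertia F) : φ.1 ⟨σ, hIU hσ⟩ = 0 := by
  obtain ⟨ϖ, hϖ⟩ := IsDiscreteValuationRing.exists_irreducible 𝒪[F]
  -- `w = τ σ τ⁻¹ σ^{-q^m} ∈ P_F`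
  have hw := conj_mul_pow_inv_mem_absWildInertia hϖ.ne_zero hτ hσ
  have hwI : τ * σ * τ⁻¹ * (σ ^ residueFieldCard F ^ m)⁻¹ ∈ absInertia F :=
    absWildInertia_le_absInertia F ϖ hw
  have hφw : φ.1 ⟨_, hIU hwI⟩ = 0 :=
    apply_eq_zero_of_mem_absWildInertia X hIU φ hU hX hV hϖ hw
  -- in `U`: `τ σ τ⁻¹ = w * σ^{q^m}`
  set t : U := ⟨τ, hτU⟩ with ht
  set s : U := ⟨σ, hIU hσ⟩ with hs
  have hconj : t * s * t⁻¹ = ⟨_, hIU hwI⟩ * s ^ (residueFieldCard F ^ m) :=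
    Subtype.ext (by simp [ht, hs, mul_assoc])
  have hsx : ∀ x : X, X.ρ (s : absoluteGaloisGroup F) x = x := hX σ hσ
  have hwx : ∀ x : X, X.ρ ((⟨_, hIU hwI⟩ : U) : absoluteGaloisGroup F) x = x := hX _ hwI
  -- evaluate `φ(τ σ τ⁻¹)` in two ways
  have h1 : φ.1 (t * s * t⁻¹) = X.ρ τ (φ.1 s) := apply_conj_eq X φ t s hsx
  have h2 : φ.1 (t * s * t⁻¹) = ((residueFieldCard F : R) ^ m) • φ.1 s := by
    rw [hconj, apply_mul_eq_add X φ _ _ hwx, hφw, zero_add, apply_pow_eq_nsmul X φ s hsx,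
      ← Nat.cast_smul_eq_nsmul R, Nat.cast_pow]
  have hzero : X.ρ τ (φ.1 s) - ((residueFieldCard F : R) ^ m) • φ.1 s = 0 := by
    rw [← h1, h2, sub_self]
  have h0 : (fun x : X => X.ρ τ x - ((residueFieldCard F : R) ^ m) • x) (φ.1 s) =
      (fun x : X => X.ρ τ x - ((residueFieldCard F : R) ^ m) • x) 0 := by
    simp only [map_zero, smul_zero, sub_zero]
    exact hzero
  exact hinj h0

end Local

/-! ### §3 Over a number field: every inertia group above `v` -/

section Global

variable {K : Type u} [Field K] [NumberField K]
variable {R : Type v} [Ring R] [TopologicalSpace R]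
variable (X : TopRep.{u} R (absoluteGaloisGroup K)) {U : Subgroup (absoluteGaloisGroup K)}
  {v : HeightOneSpectrum (𝓞 K)} (hIU : SubgroupIsUnramifiedAt K U v)

omit [NumberField K] in
/-- The codomain-restricted decomposition embedding `res⁻¹(U) → U` along
`res = absGaloisRestrict K K_v` (a continuous homomorphism of subgroups). [folklore] -/
theorem continuous_codRestrict_absGaloisRestrict (L : Type u) [Field L] [Algebra K L] :
    Continuous fun u : U.comap (absGaloisRestrict K L).toMonoidHom =>
      (⟨absGaloisRestrict K L u, u.2⟩ : U) :=
  ((absGaloisRestrict K L).continuous_toFun.comp continuous_subtype_val).subtype_mk _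

/-- **THE `𝔓₀`-CASE.**  A cocycle on `U` with values in `X` vanishes on the inertia group of the
prime `𝔓₀ = adicCompletionPrime K v` of the completion, under `hX` / `hV` / `hFrob` (module
docstring §3): pull `φ` back along `res : Γ_{K_v} → Γ_K` to the open subgroup `res⁻¹(U) ⊇ I_{K_v}`
and apply §2 with `τ = Frob_{K_v}^n`, `n ≥ 1` the first exponent with `(res Frob_{K_v})^n ∈ U`
(finite index). [folklore] -/
theorem apply_eq_zero_of_mem_inertia_adicCompletionPrime (hU : IsOpen (U : Set (absoluteGaloisGroup K)))
    (hX : ∀ 𝔓 ∈ v.primesAbove, ∀ σ ∈ 𝔓.inertia (absoluteGaloisGroup K), ∀ x : X, X.ρ σ x = x)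
    (hV : ∀ x : X, x ≠ 0 → ∃ (V : AddSubgroup X) (N : ℕ), IsOpen (V : Set X) ∧ x ∉ V ∧
      (N : 𝓞 K) ∉ v.asIdeal ∧ ∀ y : X, N • y ∈ V)
    (hFrob : ∀ 𝔓 ∈ v.primesAbove, ∀ σ : absoluteGaloisGroup K, IsArithFrobAt (𝓞 K) σ 𝔓 →
      ∀ m : ℕ, 0 < m → σ ^ m ∈ U →
        Function.Injective fun x : X => X.ρ (σ ^ m) x - ((v.residueCard : R) ^ m) • x)
    (φ : contOneCocycles (subgroupRep X U))
    {σ : absoluteGaloisGroup K}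
    (hσ : σ ∈ (adicCompletionPrime K v).inertia (absoluteGaloisGroup K)) :
    φ.1 ⟨σ, hIU _ (adicCompletionPrime_mem_primesAbove K v) hσ⟩ = 0 := by
  classical
  set L := v.adicCompletion K with hL
  set res := absGaloisRestrict K L with hres_def
  have h𝔓₀ := adicCompletionPrime_mem_primesAbove K v
  -- the local data: `U' = res⁻¹(U) ⊇ I_{K_v}`, `X' = X|Γ_{K_v}`, `ψ = φ ∘ res`
  set U' : Subgroup (absoluteGaloisGroup L) := U.comap res.toMonoidHom with hU'
  have hIres : ∀ t ∈ absInertia L, res t ∈ (adicCompletionPrime K v).inertia (absoluteGaloisGroup K) :=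
    fun t ht => by
      rw [inertia_adicCompletionPrime_eq_map_absInertia]
      exact Subgroup.mem_map_of_mem _ ht
  have hIU' : absInertia L ≤ U' := fun t ht => by
    rw [hU', Subgroup.mem_comap]
    exact hIU _ h𝔓₀ (hIres t ht)
  have hU'o : IsOpen (U' : Set (absoluteGaloisGroup L)) := by
    rw [hU', Subgroup.coe_comap]
    exact hU.preimage res.continuous_toFun
  let X' : TopRep.{u} R (absoluteGaloisGroup L) := TopRep.res (res : absoluteGaloisGroup L →* _) X
  let θ : U' →ₜ* U :=
    { toFun := fun u => ⟨res u, u.2⟩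
      map_one' := Subtype.ext (by simp)
      map_mul' := fun a b => Subtype.ext (by simp)
      continuous_toFun := continuous_codRestrict_absGaloisRestrict L }
  let ψ : contOneCocycles (subgroupRep X' U') :=
    contOneCocycles.pullback θ (X := subgroupRep X U) (Y := subgroupRep X' U')
      (TopRep.ofHom ⟨ContinuousLinearMap.id R X, fun _ => rfl⟩) φ
  have hψ : ∀ u : U', ψ.1 u = φ.1 ⟨res u, u.2⟩ := fun u => rfl
  -- the hypotheses of §2 for `(X', U', ψ)`
  have hX' : ∀ t ∈ absInertia L, ∀ x : X', X'.ρ t x = x := fun t ht x =>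
    hX _ h𝔓₀ _ (hIres t ht) x
  have hV' : ∀ x : X', x ≠ 0 → ∃ (V : AddSubgroup X') (N : ℕ), IsOpen (V : Set X') ∧ x ∉ V ∧
      ¬ ringChar 𝓀[L] ∣ N ∧ ∀ y : X', N • y ∈ V := fun x hx => by
    obtain ⟨V, N, hVo, hxV, hN, hNV⟩ := hV x hx
    exact ⟨V, N, hVo, hxV, not_ringChar_residueField_adicCompletion_dvd K v hN, hNV⟩
  -- a local Frobenius and its first power inside `U`
  obtain ⟨φ₀, hφ₀⟩ := exists_isAbsArithFrob_holds L
  have hφ₀1 : IsFrobPow φ₀ 1 := IsAbsArithFrob.isFrobPow_holds hφ₀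
  have hres0 : IsArithFrobAt (𝓞 K) (res φ₀) (adicCompletionPrime K v) :=
    (isArithFrobAt_absGaloisRestrict_adicCompletionPrime_iff K v
      (by rw [Literature.NumberTheory.Automorphic.residueFieldCard_adicCompletion_eq K v,
        HeightOneSpectrum.residueCard_eq_card_quotient]) φ₀).2 hφ₀
  haveI : CompactSpace (absoluteGaloisGroup K) := absoluteGaloisGroup_compactSpace K
  haveI : U.FiniteIndex := finiteIndex_of_isOpen_of_compactSpace U hU
  obtain ⟨n, hn0, -, hnU⟩ :=
    U.exists_pow_mem_of_index_ne_zero Subgroup.FiniteIndex.index_ne_zero (res φ₀)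
  have hτU' : φ₀ ^ n ∈ U' := by
    rw [hU', Subgroup.mem_comap]
    change res (φ₀ ^ n) ∈ U
    rw [map_pow]
    exact hnU
  have hτ : IsFrobPow (φ₀ ^ n) (n : ℕ) := isFrobPow_pow_natCast hφ₀1 n
  have hq : residueFieldCard L = v.residueCard :=
    Literature.NumberTheory.Automorphic.residueFieldCard_adicCompletion_eq K v
  have hinj' : Function.Injective fun x : X' => X'.ρ (φ₀ ^ n) x - ((residueFieldCard L : R) ^ n) • x := by
    have h := hFrob _ h𝔓₀ (res φ₀) hres0 n hn0 hnU
    have heq : (fun x : X' => X'.ρ (φ₀ ^ n) x - ((residueFieldCard L : R) ^ n) • x) =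
        fun x : X => X.ρ (res φ₀ ^ n) x - ((v.residueCard : R) ^ n) • x := by
      funext x
      rw [hq, ← map_pow]
      rfl
    rw [heq]
    exact h
  -- §2 at the local inertia, then `I_{𝔓₀} = res (I_{K_v})`
  have hloc : ∀ t (ht : t ∈ absInertia L), ψ.1 ⟨t, hIU' ht⟩ = 0 := fun t ht =>
    apply_eq_zero_of_mem_absInertia X' hIU' ψ hU'o hX' hV' hτU' hτ hinj' ht
  have hσ' := hσ
  rw [inertia_adicCompletionPrime_eq_map_absInertia] at hσ'
  obtain ⟨t, ht, rfl⟩ := Subgroup.mem_map.mp hσ'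
  have h := hloc t ht
  rw [hψ] at h
  exact h

/-- **THEOREM (cocycles of an unramified representation vanish on inertia).**  Let `U ⊴ Γ_K` be
open and unramified at the finite place `v` (`I_𝔓 ≤ U` for all `𝔓 ∣ v`), `X` a topological
representation of `Γ_K` on which every `I_𝔓`, `𝔓 ∣ v`, acts trivially, `v`-adically separated
(`hV`), and such that `ρ(Fr)^m − q_v^m` is injective on `X` for the arithmetic Frobenii `Fr` at the
primes above `v` and the `m ≥ 1` with `Fr^m ∈ U` (`hFrob`).  Then EVERY continuous crossed
homomorphism `φ : U → X` vanishes on every `I_𝔓`, `𝔓 ∣ v`.  (At `𝔓₀`: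
`apply_eq_zero_of_mem_inertia_adicCompletionPrime`; at `𝔓` with `δ • 𝔓 = 𝔓₀`: the `𝔓₀`-case for
the conjugated cocycle `u ↦ δ · φ(δ⁻¹ u δ)`.)  For an Euler system this is the statement that the
classes `c_{F(r)} ∈ H¹(F(r), T)` are unramified at the good primes `v ∤ r p`, the input of
[Rubin00] Thm. 4.5.1 / [MR04] Prop. A.2 at such `v`.
[cite: Rubin2000, Thm. 4.5.1 and Lemma 1.3.5] [cite: MazurRubin2004, App. A Prop. A.2 and Remark A.5 (pp. 79–81)] -/
theorem apply_eq_zero_of_mem_inertia [U.Normal] (hU : IsOpen (U : Set (absoluteGaloisGroup K)))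
    (hX : ∀ 𝔓 ∈ v.primesAbove, ∀ σ ∈ 𝔓.inertia (absoluteGaloisGroup K), ∀ x : X, X.ρ σ x = x)
    (hV : ∀ x : X, x ≠ 0 → ∃ (V : AddSubgroup X) (N : ℕ), IsOpen (V : Set X) ∧ x ∉ V ∧
      (N : 𝓞 K) ∉ v.asIdeal ∧ ∀ y : X, N • y ∈ V)
    (hFrob : ∀ 𝔓 ∈ v.primesAbove, ∀ σ : absoluteGaloisGroup K, IsArithFrobAt (𝓞 K) σ 𝔓 →
      ∀ m : ℕ, 0 < m → σ ^ m ∈ U →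
        Function.Injective fun x : X => X.ρ (σ ^ m) x - ((v.residueCard : R) ^ m) • x)
    (φ : contOneCocycles (subgroupRep X U))
    {𝔓 : Ideal (absIntegers (𝓞 K) K)} (h𝔓 : 𝔓 ∈ v.primesAbove) {σ : absoluteGaloisGroup K}
    (hσ : σ ∈ 𝔓.inertia (absoluteGaloisGroup K)) : φ.1 ⟨σ, hIU 𝔓 h𝔓 hσ⟩ = 0 := by
  have h𝔓₀ := adicCompletionPrime_mem_primesAbove K v
  obtain ⟨δ, hδ⟩ := HeightOneSpectrum.exists_smul_eq_of_mem_primesAbove_holds h𝔓 h𝔓₀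
  -- `σ' = δ σ δ⁻¹ ∈ I_{𝔓₀}`
  have hσ' : δ * σ * δ⁻¹ ∈ (adicCompletionPrime K v).inertia (absoluteGaloisGroup K) := by
    have h := conj_mem_inertia_smul hσ δ
    rwa [hδ] at h
  -- the conjugated cocycle `u ↦ δ · φ(δ⁻¹ u δ)` vanishes at `σ'`
  have h := apply_eq_zero_of_mem_inertia_adicCompletionPrime X hIU hU hX hV hFrob
    (contOneCocycles.pullback (subgroupConj U δ) (conjRepHom X U δ) φ) hσ'
  rw [conj_pullback_apply] at h
  have hconj : subgroupConj U δ ⟨δ * σ * δ⁻¹, hIU _ h𝔓₀ hσ'⟩ = ⟨σ, hIU 𝔓 h𝔓 hσ⟩ :=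
    Subtype.ext (by simp only [subgroupConj_apply_coe]; group)
  rw [hconj] at h
  have h' := congrArg (X.ρ δ⁻¹) h
  rwa [ρ_inv_apply_ρ_apply, map_zero] at h'

end Global

end Inertia

end Derivative

end Summit.BirchSwinnertonDyer.Rank1Residual.GaloisImage

end
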